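/-
Literature file (hubbard-downfold / hubbard-eph front-ends): the Sommerfeld coefficient `γ = (π²/3) k_B² N(E_F)(1 + λ)`
with the SI-2019 exact constants — the conversion constant `2.35714… mJ mol⁻¹ K⁻²` per state/eV/f.u.
certified from Mathlib's bounds on `π`, and the interval rules by which a measured `γ` and a band
`N(E_F)` bracket the thermal mass enhancement `1 + λ`.
-/
import Mathlib.Analysis.Real.Pi.Bounds
import HarnessLib

/-!
# The Sommerfeld coefficient and the thermal mass enhancement

The low-temperature electronic specific heat of a metal is `C_el = γ T` with
`γ = (π²/3) k_B² D(ε_F)` (Kittel, ch. 6 Eq. (25); free-electron Sommerfeld theory, valid for any band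
metal with `D(ε_F)` the density of states at the Fermi level for both spin directions), and the observed
`γ` exceeds the band value by the «thermal effective mass» ratio `m_th/m = γ(observed)/γ(band)` (Kittel
Eq. (26)), which many-body theory identifies with the mass enhancement `1 + λ` of the quasiparticles at the
Fermi level (electron–phonon plus any electronic contribution; printed and used in that form by e.g.
Kuneš–Jeong–Pickett 2004 for KOs₂O₆, «γ/γ_b = 1 + λ», and Singh–Mazin 2001 for MgCNi₃,
«γ/γ_band = 2.6»). Screening pipelines on the conventional branch of this programme's material oracle
pre-register the «thermodynamic closure» `N(E_F)·(1 + λ) = γ_exp / c` as a second observable next to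
`T_c`, with the conversion constant `c` quoted as `2.357` (or `2.3573`) mJ mol⁻¹ K⁻² per state eV⁻¹ f.u.⁻¹.

Since the 2019 redefinition of the SI the three constants entering `c = (π²/3)·k_B²·N_A/e` (with `N(E_F)`
per eV per formula unit and `γ` per mole of formula units) are EXACT decimal numbers
(`k_B = 1.380649 × 10⁻²³ J K⁻¹`, `e = 1.602176634 × 10⁻¹⁹ J eV⁻¹`, `N_A = 6.02214076 × 10²³ mol⁻¹`;
SI Brochure, 9th ed., §2.2 / Table 1), so `c` is `π²` times an explicit rational number and can be
CERTIFIED: this file proves `2.357140 < c < 2.357142` (in mJ mol⁻¹ K⁻² per state eV⁻¹ f.u.⁻¹) from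
Mathlib's `3.141592 < π < 3.141593`. Everything else is first-year algebra on the printed formula, stated
so that boxes map to bands by corners.

Proved here:
* `sommerfeldConstant_eq_rat_mul_pi_sq` — `c = (286983862482266316319 / 1201632475500000000000)·π²`
  exactly (the rational is `10³·k_B²·N_A/(3e)` in SI-2019 numbers);
* `sommerfeldConstant_bounds` — `2.357140 < c < 2.357142`; `sommerfeldConstant_pos`;
* `sommerfeldGamma N lam = c · N · (1 + lam)` [Kittel (25)–(26)]: monotone in `N` (for `1 + λ ≥ 0`) and in
  `λ` (for `N ≥ 0`), positive on the physical domain, and the box → band rule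
  `sommerfeldGamma_mem_Icc_of_mem_box`;
* the THERMAL MASS ENHANCEMENT read off a measured `γ` and a band `N(E_F)`:
  `thermalLambda γ N = γ/(c N) − 1` with `one_add_thermalLambda` (`1 + λ_th = γ/(cN)`),
  `sommerfeldGamma_thermalLambda` (round trip), monotone in `γ`, antitone in `N`, and the box → band rule
  `thermalLambda_mem_Icc_of_mem_box` (corners `(γ₋, N₊)` and `(γ₊, N₋)`) — the exact content of
  «γ interval × N(E_F) interval ⇒ (1 + λ) interval, never a point»;
* a located numerical witness: with Singh–Mazin's full-potential `N(E_F) = 4.99` states/eV/f.u. for MgCNi₃ the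
  band value is `11.76 < γ_b < 11.77` mJ mol⁻¹ K⁻² per formula unit, so their measured
  `γ ≈ 10 mJ/(mol Ni K²) = 30 mJ/(mol f.u. K²)` gives `2.54 < γ/γ_b < 2.56`, the printed «2.6»
  (`mgcni3_band_gamma_bounds`, `mgcni3_enhancement_bounds`);
* the MOLE-ENTITY BOOKKEEPING (per formula unit vs per cell of `Z` formula units, or per atom):
  `sommerfeldGamma_mul_N` (`γ(kN) = kγ(N)`), `thermalLambda_mul_mul` (consistent rescaling of `γ` and `N`
  leaves `λ_th` unchanged), `one_add_thermalLambda_mul_N` / `thermalLambda_mul_N` (rescaling only `N` by `k`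
  divides `1 + λ_th` by `k`), `thermalLambda_mul_N_lt` (and so understates it for `k > 1`), with located
  witnesses: SrPt₃P (`Z = 2`; Nekrasov–Sadovskii's per-cell `N(E_F) = 4.69` read against Takayama's per-f.u.
  `γ = 12.7` gives the printed «λ ≈ 0.15», per formula unit `1.29 < λ_th < 1.30`, ratio exactly `2`;
  Subedi–Ortenzi–Boeri's `γ_N = 12.9`; Kang et al.'s member), SrNi₂As₂ (Shein–Ivanovskii `γ_b = 7.48`,
  `0.16 < λ_th < 0.17` against `γ = 8.7`), Sr₄V₂O₆Fe₂As₂ (Sefat et al.'s per-cell `γ_b` values and one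
  internally inconsistent printed pair).

Conventions. `N(E_F)` in states per eV per formula unit counting BOTH spins; `γ` in mJ per mole of formula
units per K². A per-spin density of states must be doubled, a per-atom `γ` multiplied by the number of such
atoms per formula unit, and a states/Ry value divided by the Rydberg energy in eV (13.6057 eV — NOT an exact
SI number, deliberately not defined here) before these statements apply; those are the three unit slips the
closure is exposed to, and they are the user's bookkeeping. Nothing here asserts a value of `λ`, `γ` or
`N(E_F)` for any material, nor that `γ_obs/γ_band` is purely electron–phonon.

## References
* [Kittel1976] C. Kittel, *Introduction to Solid State Physics*, 5th ed., Wiley (1976), ch. 6 «Free electron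
  Fermi gas», Eq. (25) `C_el = ⅓π² D(ε_F) k_B² T`, Eq. (26) `m_th/m = γ(observed)/γ(free)`, Table 2.
* [BIPM2019] BIPM, *The International System of Units (SI Brochure)*, 9th ed. (2019), §2.2 and Table 1 (exact
  values of `k`, `e`, `N_A`).
* [KunesJeongPickett2004] J. Kuneš, T. Jeong, W. E. Pickett, Phys. Rev. B 70 (2004) 174510, §III.B and Table I
  (`N(E_F) = 28.2` states/Ry/Os ⇒ `γ_b = 4.9` mJ K⁻² mol-Os⁻¹; «`γ/γ_b = 1 + λ` gives … `λ = 2.9`»).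
* [SinghMazin2001] D. J. Singh, I. I. Mazin, Phys. Rev. B 64 (2001) 140507(R) (`N(E_F) = 4.99` eV⁻¹ per
  formula unit; «`γ ≈ 10` mJ/mole Ni K² … specific heat renormalization `γ/γ_band = 2.6`»).
* [NekrasovSadovskii2012APt3P] I. A. Nekrasov, M. V. Sadovskii, JETP Lett. 96 (2012) 227 = arXiv:1205.5387,
  p. 2 («N(E_F) … 4.69 states/eV/cell and 3.77 states/eV/cell … γ_b = (π²/3)N(E_F) we obtain 11 mJ/mol/K² and
  8.9 mJ/mol/K² … γ_exp = 12.7 mJ/mol/K² … an estimate of λ of the order of 0.15 only»).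
* [TakayamaEtAl2012SrPt3P] T. Takayama, K. Kuwano, D. Hirai, Y. Katsura, A. Yamamoto, H. Takagi, Phys. Rev.
  Lett. 108 (2012) 237001 = arXiv:1205.1589, Table 1 (`P4/nmm`, `Z = 2`) and p. 4 («γ = 12.7 mJ/mol·K²»).
* [SubediOrtenziBoeri2013APt3P] A. Subedi, L. Ortenzi, L. Boeri, Phys. Rev. B 87 (2013) 144504 =
  arXiv:1209.5253, Table II (`N(0) = 2.36` states/eV/spin/unit cell, `λ = 1.33` for SrPt₃P) and Table III
  («γ_N 12.9 (12.7)»); p. 2 («the unit cell comprises two f.u.»).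
* [KangEtAl2013SrPt3P] C.-J. Kang, K.-H. Ahn, K.-W. Lee, B. I. Min, J. Phys. Soc. Jpn. 82 (2013) 053703 =
  arXiv:1207.6196, Table I (`N(E_F) = 3.95` states/eV per unit cell, `λ = 1.06` for SrPt₃P).
* [SheinIvanovskii2009SrNi2As2] I. R. Shein, A. L. Ivanovskii, Solid State Commun. 150 (2010) 640 =
  arXiv:0908.4135, Table 3 (SrNi₂As₂: `N_tot(E_F) = 3.173`, `γ = 7.48 (8.7 [exp.])`).
* [SefatEtAl2010Sr4V2O6Fe2As2] A. S. Sefat, D. J. Singh, V. O. Garlea, Y. L. Zuev, M. A. McGuire, L. VanBebber,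
  B. C. Sales, arXiv:1009.4911 (2010), p. 8 («N(E_F) = 18.1 eV⁻¹ per unit cell … γ_b = 43 mJ K⁻² mol⁻¹ (mole
  of two V atoms unit cell). With ferromagnetism … 9.6 … 22.7 … 2.3 eV⁻¹ per cell, corresponding to
  γ_b = 10.7»).
* [GutowskaEtAl2021SrIr2SrRh2] S. Gutowska, K. Górnicka, P. Wójcik, T. Klimczuk, B. Wiendlocha, Phys. Rev. B 104 (2021)
  054505 = arXiv:2108.03692, TABLE I (γ by source) and TABLE III (`N(E_F)` without/with SOC, `γ_band`, `λ_γ` for SrIr₂,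
  SrRh₂, Ir, Rh), p. 8.
-/

noncomputable section

namespace Literature.MathematicalPhysics.QuantumManyBody

namespace Sommerfeld

/-! ## The SI-2019 exact constants -/

/-- The Boltzmann constant `k = 1.380649 × 10⁻²³ J K⁻¹`, exact since the 2019 SI redefinition.
[cite: BIPM2019, §2.2 Table 1] -/
def kB : ℝ := 1.380649e-23

/-- The elementary charge `e = 1.602176634 × 10⁻¹⁹ C`, i.e. joule per electron-volt, exact since 2019.
[cite: BIPM2019, §2.2 Table 1] -/
def eCharge : ℝ := 1.602176634e-19

/-- The Avogadro constant `N_A = 6.02214076 × 10²³ mol⁻¹`, exact since 2019. [cite: BIPM2019, §2.2 Table 1] -/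
def NA : ℝ := 6.02214076e23

/-- **The Sommerfeld conversion constant** `c = (π²/3) · k_B² · N_A / e · 10³`: the electronic specific-heat
coefficient `γ` in mJ mol⁻¹ K⁻² of a band metal whose density of states at the Fermi level is ONE state per
eV per formula unit (both spins), from `γ = ⅓ π² D(ε_F) k_B²` per formula unit times `N_A`, with `D` per
joule `= D` per eV `/ e`. [cite: Kittel1976, ch. 6 Eq. (25)] [cite: BIPM2019, §2.2 Table 1] -/
def sommerfeldConstant : ℝ := Real.pi ^ 2 / 3 * kB ^ 2 * NA / eCharge * 1000

/-- `c` is `π²` times an explicit rational number (`10³ k_B² N_A /(3e)` in SI-2019 decimals, reduced).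
[cite: BIPM2019, §2.2 Table 1] -/
theorem sommerfeldConstant_eq_rat_mul_pi_sq :
    sommerfeldConstant = (286983862482266316319 / 1201632475500000000000 : ℝ) * Real.pi ^ 2 := by
  unfold sommerfeldConstant kB NA eCharge
  ring_nf

/-- **Certified value of the conversion constant**: `2.357140 < c < 2.357142`
(mJ mol⁻¹ K⁻² per state eV⁻¹ f.u.⁻¹), from `3.141592 < π < 3.141593`. The commonly quoted `2.357` is this
number; nothing beyond the sixth significant figure depends on `π`'s digits used here.
[cite: Kittel1976, ch. 6 Eq. (25)] [cite: BIPM2019, §2.2 Table 1] -/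
theorem sommerfeldConstant_bounds : 2.357140 < sommerfeldConstant ∧ sommerfeldConstant < 2.357142 := by
  have h1 : (3.141592 : ℝ) < Real.pi := Real.pi_gt_d6
  have h2 : Real.pi < 3.141593 := Real.pi_lt_d6
  have hpos : 0 < Real.pi := Real.pi_pos
  have hlo : (3.141592 : ℝ) ^ 2 < Real.pi ^ 2 := by nlinarith
  have hhi : Real.pi ^ 2 < (3.141593 : ℝ) ^ 2 := by nlinarith
  rw [sommerfeldConstant_eq_rat_mul_pi_sq]
  norm_num at hlo hhi ⊢
  constructor <;> nlinarith [hlo, hhi]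

/-- `c > 0`. [cite: Kittel1976, ch. 6 Eq. (25)] -/
theorem sommerfeldConstant_pos : 0 < sommerfeldConstant :=
  lt_trans (by norm_num) sommerfeldConstant_bounds.1

/-! ## The Sommerfeld coefficient of a band metal with mass enhancement -/

/-- **The Sommerfeld coefficient** `γ = c · N(E_F) · (1 + λ)` in mJ mol⁻¹ K⁻², for a density of states
`N(E_F)` in states eV⁻¹ f.u.⁻¹ (both spins) and a thermal mass enhancement `1 + λ = m_th/m = γ_obs/γ_band`.
[cite: Kittel1976, ch. 6 Eqs. (25)–(26)] [cite: KunesJeongPickett2004, §III.B] -/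
def sommerfeldGamma (N lam : ℝ) : ℝ := sommerfeldConstant * N * (1 + lam)

/-- The band value (`λ = 0`) is `c · N`. [cite: Kittel1976, ch. 6 Eq. (25)] -/
theorem sommerfeldGamma_zero (N : ℝ) : sommerfeldGamma N 0 = sommerfeldConstant * N := by
  simp [sommerfeldGamma]

/-- `γ = γ_band · (1 + λ)`. [cite: Kittel1976, ch. 6 Eq. (26)] [cite: KunesJeongPickett2004, §III.B] -/
theorem sommerfeldGamma_eq_band_mul (N lam : ℝ) :
    sommerfeldGamma N lam = sommerfeldGamma N 0 * (1 + lam) := by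
  simp [sommerfeldGamma]

/-- `γ ≥ 0` on the physical domain `N ≥ 0`, `1 + λ ≥ 0`. [cite: Kittel1976, ch. 6 Eq. (25)] -/
theorem sommerfeldGamma_nonneg {N lam : ℝ} (hN : 0 ≤ N) (hl : 0 ≤ 1 + lam) : 0 ≤ sommerfeldGamma N lam := by
  unfold sommerfeldGamma
  exact mul_nonneg (mul_nonneg sommerfeldConstant_pos.le hN) hl

/-- `γ > 0` for `N > 0`, `1 + λ > 0`. [cite: Kittel1976, ch. 6 Eq. (25)] -/
theorem sommerfeldGamma_pos {N lam : ℝ} (hN : 0 < N) (hl : 0 < 1 + lam) : 0 < sommerfeldGamma N lam := by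
  unfold sommerfeldGamma
  exact mul_pos (mul_pos sommerfeldConstant_pos hN) hl

/-- `γ` is monotone in the density of states (for `1 + λ ≥ 0`). [cite: Kittel1976, ch. 6 Eq. (25)] -/
theorem sommerfeldGamma_mono_N {N₁ N₂ lam : ℝ} (hl : 0 ≤ 1 + lam) (h : N₁ ≤ N₂) :
    sommerfeldGamma N₁ lam ≤ sommerfeldGamma N₂ lam := by
  unfold sommerfeldGamma
  have := mul_le_mul_of_nonneg_left h sommerfeldConstant_pos.le
  exact mul_le_mul_of_nonneg_right this hl

/-- `γ` is monotone in the mass enhancement (for `N ≥ 0`). [cite: Kittel1976, ch. 6 Eq. (26)] -/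
theorem sommerfeldGamma_mono_lam {N l₁ l₂ : ℝ} (hN : 0 ≤ N) (h : l₁ ≤ l₂) :
    sommerfeldGamma N l₁ ≤ sommerfeldGamma N l₂ := by
  unfold sommerfeldGamma
  have hcN : 0 ≤ sommerfeldConstant * N := mul_nonneg sommerfeldConstant_pos.le hN
  exact mul_le_mul_of_nonneg_left (by linarith) hcN

/-- **Box → band for `γ`.** If `N ∈ [N₋, N₊]` with `N₋ ≥ 0` and `λ ∈ [λ₋, λ₊]` with `1 + λ₋ ≥ 0`, then
`γ ∈ [γ(N₋, λ₋), γ(N₊, λ₊)]`. [cite: Kittel1976, ch. 6 Eqs. (25)–(26)] -/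
theorem sommerfeldGamma_mem_Icc_of_mem_box {Nlo Nhi llo lhi N lam : ℝ} (hNlo : 0 ≤ Nlo) (hllo : 0 ≤ 1 + llo)
    (hN : N ∈ Set.Icc Nlo Nhi) (hl : lam ∈ Set.Icc llo lhi) :
    sommerfeldGamma N lam ∈ Set.Icc (sommerfeldGamma Nlo llo) (sommerfeldGamma Nhi lhi) := by
  obtain ⟨hN₁, hN₂⟩ := hN
  obtain ⟨hl₁, hl₂⟩ := hl
  have hN0 : 0 ≤ N := le_trans hNlo hN₁
  have hl0 : 0 ≤ 1 + lam := le_trans hllo (by linarith)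
  constructor
  · calc sommerfeldGamma Nlo llo ≤ sommerfeldGamma Nlo lam := sommerfeldGamma_mono_lam hNlo hl₁
      _ ≤ sommerfeldGamma N lam := sommerfeldGamma_mono_N hl0 hN₁
  · calc sommerfeldGamma N lam ≤ sommerfeldGamma Nhi lam := sommerfeldGamma_mono_N hl0 hN₂
      _ ≤ sommerfeldGamma Nhi lhi := sommerfeldGamma_mono_lam (le_trans hN0 hN₂) hl₂

/-! ## The thermal mass enhancement read off a measured `γ` and a band `N(E_F)` -/

/-- **The thermal mass enhancement** `λ_th = γ_obs/(c · N_band) − 1`, i.e. `1 + λ_th = γ_obs/γ_band = m_th/m`.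
[cite: Kittel1976, ch. 6 Eq. (26)] [cite: KunesJeongPickett2004, §III.B] -/
def thermalLambda (gamma N : ℝ) : ℝ := gamma / (sommerfeldConstant * N) - 1

/-- `1 + λ_th = γ/(cN)`. [cite: Kittel1976, ch. 6 Eq. (26)] -/
theorem one_add_thermalLambda (gamma N : ℝ) :
    1 + thermalLambda gamma N = gamma / (sommerfeldConstant * N) := by
  unfold thermalLambda; ring

/-- **Round trip**: the enhancement read off `γ` reproduces `γ` (`N ≠ 0`):
`sommerfeldGamma N (thermalLambda γ N) = γ`. [cite: Kittel1976, ch. 6 Eqs. (25)–(26)] -/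
theorem sommerfeldGamma_thermalLambda {gamma N : ℝ} (hN : N ≠ 0) :
    sommerfeldGamma N (thermalLambda gamma N) = gamma := by
  unfold sommerfeldGamma thermalLambda
  have hc : sommerfeldConstant ≠ 0 := sommerfeldConstant_pos.ne'
  field_simp
  ring

/-- Conversely the enhancement of `γ = c N (1 + λ)` is `λ` (`N ≠ 0`). [cite: Kittel1976, ch. 6 Eqs. (25)–(26)] -/
theorem thermalLambda_sommerfeldGamma {N : ℝ} (lam : ℝ) (hN : N ≠ 0) :
    thermalLambda (sommerfeldGamma N lam) N = lam := by
  unfold sommerfeldGamma thermalLambda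
  have hc : sommerfeldConstant ≠ 0 := sommerfeldConstant_pos.ne'
  field_simp
  ring

/-- `λ_th` is monotone in the measured `γ` (`N > 0`). [cite: Kittel1976, ch. 6 Eq. (26)] -/
theorem thermalLambda_mono_gamma {g₁ g₂ N : ℝ} (hN : 0 < N) (h : g₁ ≤ g₂) :
    thermalLambda g₁ N ≤ thermalLambda g₂ N := by
  unfold thermalLambda
  have hcN : 0 < sommerfeldConstant * N := mul_pos sommerfeldConstant_pos hN
  have := div_le_div_of_nonneg_right h hcN.le
  linarith

/-- `λ_th` is antitone in the band density of states (`γ ≥ 0`, `N₁ > 0`): a larger computed `N(E_F)` leaves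
less room for enhancement. [cite: Kittel1976, ch. 6 Eq. (26)] -/
theorem thermalLambda_anti_N {gamma N₁ N₂ : ℝ} (hg : 0 ≤ gamma) (hN₁ : 0 < N₁) (h : N₁ ≤ N₂) :
    thermalLambda gamma N₂ ≤ thermalLambda gamma N₁ := by
  unfold thermalLambda
  have hc := sommerfeldConstant_pos
  have h1 : 0 < sommerfeldConstant * N₁ := mul_pos hc hN₁
  have h2 : sommerfeldConstant * N₁ ≤ sommerfeldConstant * N₂ := mul_le_mul_of_nonneg_left h hc.le
  have := div_le_div_of_nonneg_left hg h1 h2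
  linarith

/-- **Box → band for the enhancement.** If the measured `γ ∈ [γ₋, γ₊]` (`γ₋ ≥ 0`) and the band
`N(E_F) ∈ [N₋, N₊]` (`N₋ > 0`), then `λ_th ∈ [λ_th(γ₋, N₊), λ_th(γ₊, N₋)]` — corners, no interior search.
[cite: Kittel1976, ch. 6 Eq. (26)] -/
theorem thermalLambda_mem_Icc_of_mem_box {glo ghi Nlo Nhi gamma N : ℝ} (hglo : 0 ≤ glo) (hNlo : 0 < Nlo)
    (hg : gamma ∈ Set.Icc glo ghi) (hN : N ∈ Set.Icc Nlo Nhi) :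
    thermalLambda gamma N ∈ Set.Icc (thermalLambda glo Nhi) (thermalLambda ghi Nlo) := by
  obtain ⟨hg₁, hg₂⟩ := hg
  obtain ⟨hN₁, hN₂⟩ := hN
  have hN0 : 0 < N := lt_of_lt_of_le hNlo hN₁
  have hg0 : 0 ≤ gamma := le_trans hglo hg₁
  constructor
  · calc thermalLambda glo Nhi ≤ thermalLambda glo N := thermalLambda_anti_N hglo hN0 hN₂
      _ ≤ thermalLambda gamma N := thermalLambda_mono_gamma hN0 hg₁
  · calc thermalLambda gamma N ≤ thermalLambda ghi N := thermalLambda_mono_gamma hN0 hg₂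
      _ ≤ thermalLambda ghi Nlo := thermalLambda_anti_N (le_trans hg0 hg₂) hNlo hN₁

/-- The enhancement is nonnegative exactly when the measured `γ` is at least the band value (`N > 0`).
[cite: Kittel1976, ch. 6 Eq. (26)] -/
theorem thermalLambda_nonneg_iff {gamma N : ℝ} (hN : 0 < N) :
    0 ≤ thermalLambda gamma N ↔ sommerfeldGamma N 0 ≤ gamma := by
  unfold thermalLambda sommerfeldGamma
  have hcN : 0 < sommerfeldConstant * N := mul_pos sommerfeldConstant_pos hN
  rw [sub_nonneg, le_div_iff₀ hcN]
  simp

/-! ## A located numerical witness (MgCNi₃, Singh–Mazin 2001) -/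

/-- With the full-potential `N(E_F) = 4.99` states eV⁻¹ f.u.⁻¹ printed for MgCNi₃ the band Sommerfeld
coefficient is `11.76 < γ_b < 11.77` mJ mol⁻¹ K⁻² per formula unit.
[cite: SinghMazin2001, p. 2 «The value of N(E_F) is 4.99 eV⁻¹ on a per formula unit basis»] -/
theorem mgcni3_band_gamma_bounds : 11.76 < sommerfeldGamma 4.99 0 ∧ sommerfeldGamma 4.99 0 < 11.77 := by
  have ⟨h1, h2⟩ := sommerfeldConstant_bounds
  unfold sommerfeldGamma
  constructor <;> nlinarith

/-- With the measured `γ ≈ 10` mJ per mole Ni per K², i.e. `30` per mole of formula units (three Ni), the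
thermal enhancement ratio is `2.54 < γ/γ_b < 2.56` — the printed «specific heat renormalization
γ/γ_band = 2.6» at its stated precision. [cite: SinghMazin2001, p. 2] -/
theorem mgcni3_enhancement_bounds :
    2.54 < 1 + thermalLambda 30 4.99 ∧ 1 + thermalLambda 30 4.99 < 2.56 := by
  have ⟨h1, h2⟩ := sommerfeldConstant_bounds
  rw [one_add_thermalLambda]
  have hpos : 0 < sommerfeldConstant * 4.99 := by nlinarith
  constructor
  · rw [lt_div_iff₀ hpos]; nlinarith
  · rw [div_lt_iff₀ hpos]; nlinarith

/-! ## Mole-entity bookkeeping: per formula unit versus per cell of `Z` formula units (or per atom)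

`γ` and `N(E_F)` enter `γ = c · N · (1 + λ)` per the SAME mole entity. A density of states printed «per unit
cell» for a cell of `Z` formula units is `Z` times the per-f.u. value, and a `γ` printed «per gram-atom» is
`1/n_at` of the per-f.u. value. Rescaling BOTH by the same factor leaves `λ_th` unchanged
(`thermalLambda_mul_mul`); rescaling ONLY the density of states by `k` divides the ratio `1 + λ_th` by `k`
(`one_add_thermalLambda_mul_N`), i.e. understates the enhancement for `k > 1` (`thermalLambda_mul_N_lt`).
This is the fourth unit slip next to the three named in the header, typed because it is in print: for SrPt₃P
(antipolar antiperovskite, `P4/nmm`, `Z = 2` [TakayamaEtAl2012SrPt3P, Table 1]) Nekrasov–Sadovskii read their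
LMTO `N(E_F) = 4.69` states/eV/CELL as `γ_b = 11 mJ/mol/K²` against Takayama's measured `γ = 12.7` per mole
of FORMULA UNITS and concluded «λ of the order of 0.15 only … rather weak coupling»
[NekrasovSadovskii2012APt3P, p. 2]; per formula unit the same numbers give `1 + λ_th ≈ 2.30`, which is the
bookkeeping of Subedi–Ortenzi–Boeri (`N(0) = 2.36` states/eV/spin/cell, `λ = 1.33`, `γ_N = 12.9 (12.7)`
[SubediOrtenziBoeri2013APt3P, Tables II–III]). The witnesses below certify both readings and their exact
ratio `Z = 2`; which reading a user adopts is not asserted here — only that they differ by `Z` and why.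
-/

/-- `γ` per mole of an entity `k` times larger is `k` times larger: `γ(k·N, λ) = k · γ(N, λ)` (per cell of
`Z = k` formula units from per f.u.; per f.u. from per atom with `k = n_at`). [cite: Kittel1976, ch. 6 Eq. (25)] -/
theorem sommerfeldGamma_mul_N (k N lam : ℝ) : sommerfeldGamma (k * N) lam = k * sommerfeldGamma N lam := by
  unfold sommerfeldGamma; ring

/-- **Consistent rescaling is harmless**: `γ` and `N(E_F)` both per the `k`-fold entity give the same
enhancement, `λ_th(k·γ, k·N) = λ_th(γ, N)` (`k ≠ 0`). [cite: Kittel1976, ch. 6 Eq. (26)] -/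
theorem thermalLambda_mul_mul {k : ℝ} (hk : k ≠ 0) (gamma N : ℝ) :
    thermalLambda (k * gamma) (k * N) = thermalLambda gamma N := by
  unfold thermalLambda
  rw [mul_left_comm sommerfeldConstant k N, mul_div_mul_left _ _ hk]

/-- **Inconsistent rescaling divides the ratio**: a density of states per a `k`-fold entity (e.g. per cell of
`Z = k` formula units) read against a `γ` per formula unit gives `1 + λ_th(γ, k·N) = (1 + λ_th(γ, N))/k`.
[cite: Kittel1976, ch. 6 Eq. (26)] [cite: NekrasovSadovskii2012APt3P, p. 2] -/
theorem one_add_thermalLambda_mul_N (k gamma N : ℝ) :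
    1 + thermalLambda gamma (k * N) = (1 + thermalLambda gamma N) / k := by
  rw [one_add_thermalLambda, one_add_thermalLambda, mul_left_comm sommerfeldConstant k N,
    div_mul_eq_div_div_swap]

/-- Equivalently `λ_th(γ, k·N) = (1 + λ_th(γ, N))/k − 1`. [cite: Kittel1976, ch. 6 Eq. (26)] -/
theorem thermalLambda_mul_N (k gamma N : ℝ) :
    thermalLambda gamma (k * N) = (1 + thermalLambda gamma N) / k - 1 := by
  have := one_add_thermalLambda_mul_N k gamma N
  linarith

/-- For `k > 1`, `γ > 0`, `N > 0` the per-`k`-fold-entity misreading strictly UNDERSTATES the enhancement: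
`λ_th(γ, k·N) < λ_th(γ, N)`. [cite: Kittel1976, ch. 6 Eq. (26)] -/
theorem thermalLambda_mul_N_lt {k gamma N : ℝ} (hk : 1 < k) (hg : 0 < gamma) (hN : 0 < N) :
    thermalLambda gamma (k * N) < thermalLambda gamma N := by
  unfold thermalLambda
  have hc := sommerfeldConstant_pos
  have h1 : 0 < sommerfeldConstant * N := mul_pos hc hN
  have h2 : sommerfeldConstant * N < sommerfeldConstant * (k * N) := by nlinarith
  have := div_lt_div_of_pos_left hg h1 h2
  linarith

/-! ### Located instance: SrPt₃P (`P4/nmm`, `Z = 2`) -/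

/-- LMTO-LDA `N(E_F) = 4.69` states eV⁻¹ per CELL of SrPt₃P gives `11.05 < γ_b < 11.06` mJ K⁻² per mole of
CELLS — the printed «11 mJ/mol/K²». [cite: NekrasovSadovskii2012APt3P, p. 2] -/
theorem srpt3p_band_gamma_perCell_bounds :
    11.05 < sommerfeldGamma 4.69 0 ∧ sommerfeldGamma 4.69 0 < 11.06 := by
  have ⟨h1, h2⟩ := sommerfeldConstant_bounds
  unfold sommerfeldGamma
  constructor <;> nlinarith

/-- Per FORMULA UNIT (`Z = 2`, `N(E_F) = 4.69/2`): `5.52 < γ_b < 5.53` mJ mol⁻¹ K⁻².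
[cite: NekrasovSadovskii2012APt3P, p. 2] [cite: TakayamaEtAl2012SrPt3P, Table 1 (Z = 2)] -/
theorem srpt3p_band_gamma_perFU_bounds :
    5.52 < sommerfeldGamma (4.69 / 2) 0 ∧ sommerfeldGamma (4.69 / 2) 0 < 5.53 := by
  have ⟨h1, h2⟩ := sommerfeldConstant_bounds
  unfold sommerfeldGamma
  constructor <;> nlinarith

/-- Reading the per-cell `4.69` against Takayama's measured `γ = 12.7` mJ mol⁻¹ K⁻² (per mole SrPt₃P):
`0.14 < λ_th < 0.15` — the printed «λ of the order of 0.15 only».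
[cite: NekrasovSadovskii2012APt3P, p. 2] [cite: TakayamaEtAl2012SrPt3P, p. 4 (γ = 12.7 mJ/mol·K²)] -/
theorem srpt3p_lambda_asPrinted_bounds :
    0.14 < thermalLambda 12.7 4.69 ∧ thermalLambda 12.7 4.69 < 0.15 := by
  have ⟨h1, h2⟩ := sommerfeldConstant_bounds
  unfold thermalLambda
  have hpos : 0 < sommerfeldConstant * 4.69 := by nlinarith
  constructor
  · have : (1.14 : ℝ) < 12.7 / (sommerfeldConstant * 4.69) := by rw [lt_div_iff₀ hpos]; nlinarith
    linarith
  · have : 12.7 / (sommerfeldConstant * 4.69) < (1.15 : ℝ) := by rw [div_lt_iff₀ hpos]; nlinarith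
    linarith

/-- The same numbers per formula unit: `1.29 < λ_th < 1.30` — strong coupling, Subedi–Ortenzi–Boeri's
class (`λ = 1.33`). [cite: NekrasovSadovskii2012APt3P, p. 2] [cite: TakayamaEtAl2012SrPt3P, p. 4]
[cite: SubediOrtenziBoeri2013APt3P, Table II] -/
theorem srpt3p_lambda_perFU_bounds :
    1.29 < thermalLambda 12.7 (4.69 / 2) ∧ thermalLambda 12.7 (4.69 / 2) < 1.30 := by
  have ⟨h1, h2⟩ := sommerfeldConstant_bounds
  unfold thermalLambda
  have hpos : 0 < sommerfeldConstant * (4.69 / 2) := by nlinarith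
  constructor
  · have : (2.29 : ℝ) < 12.7 / (sommerfeldConstant * (4.69 / 2)) := by rw [lt_div_iff₀ hpos]; nlinarith
    linarith
  · have : 12.7 / (sommerfeldConstant * (4.69 / 2)) < (2.30 : ℝ) := by rw [div_lt_iff₀ hpos]; nlinarith
    linarith

/-- **The two readings differ by exactly `Z = 2` in `1 + λ_th`.**
[cite: NekrasovSadovskii2012APt3P, p. 2] [cite: TakayamaEtAl2012SrPt3P, Table 1 (Z = 2)] -/
theorem srpt3p_one_add_lambda_ratio :
    1 + thermalLambda 12.7 (4.69 / 2) = 2 * (1 + thermalLambda 12.7 4.69) := by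
  have h := one_add_thermalLambda_mul_N 2 12.7 (4.69 / 2)
  have h2 : (2 : ℝ) * (4.69 / 2) = 4.69 := by norm_num
  rw [h2] at h
  linarith

/-- Subedi–Ortenzi–Boeri's own bookkeeping: `N(0) = 2.36` states eV⁻¹ spin⁻¹ cell⁻¹ = `2.36` per formula unit
for both spins (`Z = 2`), with their `λ = 1.33`: `12.96 < γ_N < 12.97` — their Table III «γ_N 12.9 (12.7)».
[cite: SubediOrtenziBoeri2013APt3P, Tables II–III] -/
theorem srpt3p_subedi_gamma_bounds :
    12.96 < sommerfeldGamma 2.36 1.33 ∧ sommerfeldGamma 2.36 1.33 < 12.97 := by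
  have ⟨h1, h2⟩ := sommerfeldConstant_bounds
  unfold sommerfeldGamma
  constructor <;> nlinarith

/-- Kang–Ahn–Lee–Min's FLAPW member: `N(E_F) = 3.95` per cell (`3.95/2` per f.u.) with their `λ = 1.06` gives
`9.58 < γ < 9.60` mJ mol⁻¹ K⁻² per formula unit (measured `12.7`): the by-code spread of `N(E_F)` propagates
linearly. [cite: KangEtAl2013SrPt3P, Table I] -/
theorem srpt3p_kang_gamma_bounds :
    9.58 < sommerfeldGamma (3.95 / 2) 1.06 ∧ sommerfeldGamma (3.95 / 2) 1.06 < 9.60 := by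
  have ⟨h1, h2⟩ := sommerfeldConstant_bounds
  unfold sommerfeldGamma
  constructor <;> nlinarith

/-! ### Located instance: SrNi₂As₂ (ThCr₂Si₂, per formula unit throughout) -/

/-- Shein–Ivanovskii's FLAPW-GGA `N(E_F) = 3.173` states eV⁻¹ f.u.⁻¹ gives `7.47 < γ_b < 7.48` (printed
`7.48`), and against Bauer et al.'s measured `γ = 8.7` the thermal enhancement is `0.16 < λ_th < 0.17`.
[cite: SheinIvanovskii2009SrNi2As2, Table 3] -/
theorem srni2as2_gamma_and_lambda_bounds :
    (7.47 < sommerfeldGamma 3.173 0 ∧ sommerfeldGamma 3.173 0 < 7.48) ∧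
    (0.16 < thermalLambda 8.7 3.173 ∧ thermalLambda 8.7 3.173 < 0.17) := by
  have ⟨h1, h2⟩ := sommerfeldConstant_bounds
  have hpos : 0 < sommerfeldConstant * 3.173 := by nlinarith
  refine ⟨?_, ?_⟩
  · unfold sommerfeldGamma
    constructor <;> nlinarith
  · unfold thermalLambda
    constructor
    · have : (1.16 : ℝ) < 8.7 / (sommerfeldConstant * 3.173) := by rw [lt_div_iff₀ hpos]; nlinarith
      linarith
    · have : 8.7 / (sommerfeldConstant * 3.173) < (1.17 : ℝ) := by rw [div_lt_iff₀ hpos]; nlinarith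
      linarith

/-! ### Located instance: Sr₄V₂O₆Fe₂As₂ (per mole of the 2-V cell, as printed) -/

/-- Sefat et al.'s non-spin-polarised PBE `N(E_F) = 18.1` eV⁻¹ per cell gives `42.66 < γ_b < 42.67` per mole
of cells (printed «43») and the ferromagnetic `9.6` gives `22.62 < γ_b < 22.63` (printed «22.7»); their
PBE+U pair «2.3 eV⁻¹ per cell … γ_b = 10.7» is NOT this map: `γ_b(2.3) < 5.43`, whereas `γ_b = 10.7`
corresponds to `4.539 < N < 4.540` — a located internal inconsistency of one printed line, recorded, not
resolved. [cite: SefatEtAl2010Sr4V2O6Fe2As2, p. 8] -/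
theorem sr4v2o6fe2as2_gamma_bookkeeping :
    (42.66 < sommerfeldGamma 18.1 0 ∧ sommerfeldGamma 18.1 0 < 42.67) ∧
    (22.62 < sommerfeldGamma 9.6 0 ∧ sommerfeldGamma 9.6 0 < 22.63) ∧
    sommerfeldGamma 2.3 0 < 5.43 ∧
    (sommerfeldGamma 4.539 0 < 10.7 ∧ 10.7 < sommerfeldGamma 4.540 0) := by
  have ⟨h1, h2⟩ := sommerfeldConstant_bounds
  unfold sommerfeldGamma
  refine ⟨⟨?_, ?_⟩, ⟨?_, ?_⟩, ?_, ⟨?_, ?_⟩⟩ <;> nlinarith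

/-! ## Spin–orbit coupling inside the `γ`-closure: the Laves phases `SrIr₂` / `SrRh₂` (appended 2026-08-27, lit-4 g14)

Gutowska et al. tabulate `N(E_F)` per formula unit WITHOUT and WITH spin–orbit coupling for the cubic Laves
superconductors `SrIr₂` (5d) and `SrRh₂` (4d) together with the measured `γ`, and read off `λ_γ = γ_expt/γ_band − 1`
[GutowskaEtAl2021SrIr2SrRh2, TABLE III]: `SrIr₂` `N(E_F) = 4.63 → 3.27` eV⁻¹ (SOC splits the DOS peak), `γ_expt = 15.5`;
`SrRh₂` `5.52 → 5.58`, `γ_expt = 27.3` mJ mol⁻¹ K⁻²; printed `λ_γ = 0.42 | 1.01` (SrIr₂ w/o | with SOC) and `1.10 | 1.08`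
(SrRh₂). The accompanying sentence «λ_γ = 1.10 only when SOC is included» (p. 8) quotes the SrRh₂ scalar-relativistic
column; the certified SrIr₂-with-SOC value is the TABLE's `1.01`. -/

/-- `SrIr₂`: band `γ` WITHOUT SOC `10.91 < γ_band(4.63) < 10.92` and WITH SOC `7.70 < γ_band(3.27) < 7.71` mJ mol⁻¹ K⁻²
(printed 10.92 / 7.72). [cite: GutowskaEtAl2021SrIr2SrRh2, TABLE III (SrIr₂ columns)] -/
theorem srIr2_band_gamma_soc :
    (10.91 < sommerfeldGamma 4.63 0 ∧ sommerfeldGamma 4.63 0 < 10.92) ∧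
    (7.70 < sommerfeldGamma 3.27 0 ∧ sommerfeldGamma 3.27 0 < 7.71) := by
  have ⟨h1, h2⟩ := sommerfeldConstant_bounds
  unfold sommerfeldGamma
  refine ⟨⟨?_, ?_⟩, ⟨?_, ?_⟩⟩ <;> nlinarith

/-- `SrIr₂`, `γ_expt = 15.5`: **`0.41 < λ_γ(w/o SOC) < 0.43`** and **`1.00 < λ_γ(with SOC) < 1.02`** — spin–orbit coupling
moves the Sommerfeld renormalisation by a factor `≈ 2.4`; the TABLE's `0.42 / 1.01` are certified (the text's «1.10» is
not the SrIr₂ value). [cite: GutowskaEtAl2021SrIr2SrRh2, TABLE III and p. 8 («λ_γ = 1.10 only when SOC is included …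
the scalar-relativistic density of states would yield λ_γ = 0.42»)] -/
theorem srIr2_lambda_gamma_soc :
    (0.41 < thermalLambda 15.5 4.63 ∧ thermalLambda 15.5 4.63 < 0.43) ∧
    (1.00 < thermalLambda 15.5 3.27 ∧ thermalLambda 15.5 3.27 < 1.02) := by
  have ⟨h1, h2⟩ := sommerfeldConstant_bounds
  have hp1 : 0 < sommerfeldConstant * 4.63 := by nlinarith
  have hp2 : 0 < sommerfeldConstant * 3.27 := by nlinarith
  unfold thermalLambda
  refine ⟨⟨?_, ?_⟩, ⟨?_, ?_⟩⟩
  · have : (1.41 : ℝ) < 15.5 / (sommerfeldConstant * 4.63) := by rw [lt_div_iff₀ hp1]; nlinarith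
    linarith
  · have : 15.5 / (sommerfeldConstant * 4.63) < (1.43 : ℝ) := by rw [div_lt_iff₀ hp1]; nlinarith
    linarith
  · have : (2.00 : ℝ) < 15.5 / (sommerfeldConstant * 3.27) := by rw [lt_div_iff₀ hp2]; nlinarith
    linarith
  · have : 15.5 / (sommerfeldConstant * 3.27) < (2.02 : ℝ) := by rw [div_lt_iff₀ hp2]; nlinarith
    linarith

/-- `SrRh₂` (4d: SOC inert on `N(E_F)`), `γ_expt = 27.3`: **`1.09 < λ_γ(w/o SOC: 5.52) < 1.10`** and
**`1.07 < λ_γ(with SOC: 5.58) < 1.08`** (printed 1.10 / 1.08). [cite: GutowskaEtAl2021SrIr2SrRh2, TABLE III (SrRh₂ columns)] -/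
theorem srRh2_lambda_gamma_soc :
    (1.09 < thermalLambda 27.3 5.52 ∧ thermalLambda 27.3 5.52 < 1.10) ∧
    (1.07 < thermalLambda 27.3 5.58 ∧ thermalLambda 27.3 5.58 < 1.08) := by
  have ⟨h1, h2⟩ := sommerfeldConstant_bounds
  have hp1 : 0 < sommerfeldConstant * 5.52 := by nlinarith
  have hp2 : 0 < sommerfeldConstant * 5.58 := by nlinarith
  unfold thermalLambda
  refine ⟨⟨?_, ?_⟩, ⟨?_, ?_⟩⟩
  · have : (2.09 : ℝ) < 27.3 / (sommerfeldConstant * 5.52) := by rw [lt_div_iff₀ hp1]; nlinarith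
    linarith
  · have : 27.3 / (sommerfeldConstant * 5.52) < (2.10 : ℝ) := by rw [div_lt_iff₀ hp1]; nlinarith
    linarith
  · have : (2.07 : ℝ) < 27.3 / (sommerfeldConstant * 5.58) := by rw [lt_div_iff₀ hp2]; nlinarith
    linarith
  · have : 27.3 / (sommerfeldConstant * 5.58) < (2.08 : ℝ) := by rw [div_lt_iff₀ hp2]; nlinarith
    linarith

/-- BY-SOURCE SPREAD: with the earlier report's `γ = 11.9` for `SrIr₂` the SOC-on renormalisation is only
`0.54 < λ_γ < 0.55` — the choice of `γ` source moves `λ_γ` as much as SOC does. [cite: GutowskaEtAl2021SrIr2SrRh2, TABLE I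
(SrIr₂ `γ` 15.5(2) this work | 11.9 earlier report) and TABLE III] -/
theorem srIr2_lambda_gamma_by_source :
    0.54 < thermalLambda 11.9 3.27 ∧ thermalLambda 11.9 3.27 < 0.55 := by
  have ⟨h1, h2⟩ := sommerfeldConstant_bounds
  have hp : 0 < sommerfeldConstant * 3.27 := by nlinarith
  unfold thermalLambda
  constructor
  · have : (1.54 : ℝ) < 11.9 / (sommerfeldConstant * 3.27) := by rw [lt_div_iff₀ hp]; nlinarith
    linarith
  · have : 11.9 / (sommerfeldConstant * 3.27) < (1.55 : ℝ) := by rw [div_lt_iff₀ hp]; nlinarith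
    linarith

/-! ## Noncentrosymmetric carbides of the hubbard-downfold v8 set (M329 `LaNiC₂`, M332 `Mo₃Al₂C`) and the
Ti-oxypnictide / Laves rows' siblings: band `γ_b`, thermal `λ_th` by `γ` source, and a projection-convention pair

References for this section:
* B. Wiendlocha, R. Szczęśniak, A. P. Durajski, M. Muras, Phys. Rev. B 94 (2016) 134517, arXiv:1610.04996, TABLE III
  (`LaNiC₂`, PBE + SOC, 0 GPa: `N(E_F)` 2.37 eV⁻¹; sphere-projected Ni 0.57, Ni-3d 0.49, La 0.47, La-5d 0.34, C 0.10, C-2p 0.09)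
  and §III.A («γ_expt ≃ 7.7 − 7.8 mJ/molK² … λ ∼ 0.4»). [WiendlochaEtAl2016LaNiC2]
* A. Subedi, D. J. Singh, Phys. Rev. B 80 (2009) 092506, arXiv:0905.0511, p. 2 («N(E_F) = 2.6 eV⁻¹ on a per formula unit
  both spin basis»). [SubediSingh2009LaNiC2]
* E. Bauer et al., Phys. Rev. B 82 (2010) 064511, arXiv:1007.0420, p. 4 («N(E_F) = 5.48 states/eV corresponds to
  γ_b = 12.9 mJ/molK², in fair agreement with γ = γ_b(1 + λ_e,ph) = 17.8 mJ/molK²»). [BauerEtAl2010Mo3Al2C]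
* A. B. Karki et al., Phys. Rev. B 82 (2010) 064512, arXiv:1007.0160, Table I (`Mo₃Al₂C` `γ_n` 18.65 mJ mol⁻¹ K⁻²).
  [KarkiEtAl2010Mo3Al2C]
-/

/-- `LaNiC₂`: the band Sommerfeld coefficient from the two printed densities of states — PBE + SOC `N(E_F) = 2.37`
⇒ **`5.58 < γ_b < 5.59`**, LDA `N(E_F) = 2.6` ⇒ **`6.12 < γ_b < 6.13`** mJ mol⁻¹ K⁻² (per f.u.).
[cite: WiendlochaEtAl2016LaNiC2, TABLE III] [cite: SubediSingh2009LaNiC2, p. 2] -/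
theorem laNiC2_band_gamma_by_functional :
    (5.58 < sommerfeldGamma 2.37 0 ∧ sommerfeldGamma 2.37 0 < 5.59) ∧
      (6.12 < sommerfeldGamma 2.6 0 ∧ sommerfeldGamma 2.6 0 < 6.13) := by
  have ⟨h1, h2⟩ := sommerfeldConstant_bounds
  unfold sommerfeldGamma
  refine ⟨⟨?_, ?_⟩, ⟨?_, ?_⟩⟩ <;> nlinarith

/-- `LaNiC₂`: the thermal coupling `λ_th = γ_n/γ_b − 1` on the measured `γ_n ∈ {7.7, 7.8}`: **`(0.37, 0.40)` on the
PBE + SOC band value 2.37** (Wiendlocha et al.'s «λ ∼ 0.4») and **`(0.25, 0.28)` on the LDA value 2.6** — the 10 %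
functional spread in `N(E_F)` moves `λ_th` by ≈ 0.13. [cite: WiendlochaEtAl2016LaNiC2, §III.A and TABLE III]
[cite: SubediSingh2009LaNiC2, p. 2] -/
theorem laNiC2_thermalLambda_by_functional :
    (0.37 < thermalLambda 7.7 2.37 ∧ thermalLambda 7.8 2.37 < 0.40) ∧
      (0.25 < thermalLambda 7.7 2.6 ∧ thermalLambda 7.8 2.6 < 0.28) := by
  have ⟨h1, h2⟩ := sommerfeldConstant_bounds
  have hp1 : 0 < sommerfeldConstant * 2.37 := by nlinarith
  have hp2 : 0 < sommerfeldConstant * 2.6 := by nlinarith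
  unfold thermalLambda
  refine ⟨⟨?_, ?_⟩, ⟨?_, ?_⟩⟩
  · rw [lt_sub_iff_add_lt, lt_div_iff₀ hp1]; nlinarith
  · rw [sub_lt_iff_lt_add, div_lt_iff₀ hp1]; nlinarith
  · rw [lt_sub_iff_add_lt, lt_div_iff₀ hp2]; nlinarith
  · rw [sub_lt_iff_lt_add, div_lt_iff₀ hp2]; nlinarith

/-- `LaNiC₂`: THE PROJECTION-CONVENTION PAIR for the Ni-3d share of `N(E_F)` (the router's `w_d` input): Ni-3d `0.49` of
the TOTAL `2.37` is **`0.206 < w < 0.207`**, but of the SPHERE-ASSIGNED part `0.57 + 0.47 + 0.10 = 1.14` it is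
**`0.429 < w < 0.430`** — below and above a threshold of `7/20` respectively; at 15 GPa the total-normalised share is
`0.240 < 0.56/2.33 < 0.241`. [cite: WiendlochaEtAl2016LaNiC2, TABLE III (0 and 15 GPa rows)] -/
theorem laNiC2_Ni3d_share_by_convention :
    ((0.206 : ℝ) < 0.49 / 2.37 ∧ (0.49 : ℝ) / 2.37 < 0.207) ∧
      ((0.429 : ℝ) < 0.49 / (0.57 + 0.47 + 0.10) ∧ (0.49 : ℝ) / (0.57 + 0.47 + 0.10) < 0.430) ∧
        ((0.49 : ℝ) / 2.37 < 7 / 20 ∧ (7 : ℝ) / 20 < 0.49 / (0.57 + 0.47 + 0.10)) ∧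
          ((0.240 : ℝ) < 0.56 / 2.33 ∧ (0.56 : ℝ) / 2.33 < 0.241) := by
  norm_num

/-- `Mo₃Al₂C`: Bauer et al.'s relativistic `N(E_F) = 5.48` states eV⁻¹ f.u.⁻¹ ⇒ **`12.91 < γ_b < 12.92`** (printed 12.9).
[cite: BauerEtAl2010Mo3Al2C, p. 4] -/
theorem mo3Al2C_band_gamma : 12.91 < sommerfeldGamma 5.48 0 ∧ sommerfeldGamma 5.48 0 < 12.92 := by
  have ⟨h1, h2⟩ := sommerfeldConstant_bounds
  unfold sommerfeldGamma
  constructor <;> nlinarith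

/-- `Mo₃Al₂C`: the thermal coupling BY `γ_n` SOURCE — **`0.37 < λ_th(17.8) < 0.38`** (Bauer) and **`0.44 < λ_th(18.65) < 0.45`**
(Karki) — against the McMillan-inverted `0.75–0.80` and `ΔC/γT_c ≈ 2.2` of the same papers: Bauer's «fair agreement with
γ = γ_b(1 + λ)» needs `λ ≈ 0.38`, not the `0.8` of the `T_c` inversion (`γ_b(1 + 0.78) > 22.9 > 17.8`).
[cite: BauerEtAl2010Mo3Al2C, p. 4 (γ_b 12.9, γ 17.8)] [cite: KarkiEtAl2010Mo3Al2C, Table I (γ_n 18.65)] -/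
theorem mo3Al2C_thermalLambda_by_source :
    (0.37 < thermalLambda 17.8 5.48 ∧ thermalLambda 17.8 5.48 < 0.38) ∧
      (0.44 < thermalLambda 18.65 5.48 ∧ thermalLambda 18.65 5.48 < 0.45) ∧
        22.9 < sommerfeldGamma 5.48 0.78 := by
  have ⟨h1, h2⟩ := sommerfeldConstant_bounds
  have hp : 0 < sommerfeldConstant * 5.48 := by nlinarith
  unfold thermalLambda sommerfeldGamma
  refine ⟨⟨?_, ?_⟩, ⟨?_, ?_⟩, ?_⟩
  · rw [lt_sub_iff_add_lt, lt_div_iff₀ hp]; nlinarith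
  · rw [sub_lt_iff_lt_add, div_lt_iff₀ hp]; nlinarith
  · rw [lt_sub_iff_add_lt, lt_div_iff₀ hp]; nlinarith
  · rw [sub_lt_iff_lt_add, div_lt_iff₀ hp]; nlinarith
  · nlinarith

end Sommerfeld

end Literature.MathematicalPhysics.QuantumManyBody
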